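import Literature.NumberTheory.LFunctions.SiegelWalfiszMoebiusProofs
import Literature.NumberTheory.Sieve.FejerKernelCounting
import HarnessLib

/-!
# Möbius sums twisted by characters to 2-power moduli up to `exp(c√log x)` (Green 2012, Theorem 3)

Topic `Literature/NumberTheory/LFunctions`. Everything in this file is PROVED (theorems only; no
named facts, no definitions).

B. Green, *On (not) computing the Möbius function using bounded depth circuits*, Combin. Probab.
Comput. 21 (2012) 942–951 (= arXiv:1103.4991) [Green2012], §4, Theorem 3:

> For some absolute constant `c₂ > 0` the following is true. Suppose that `χ` is a Dirichlet
> character to modulus `q = 2^t`, `q ≤ e^{c₂√log N}`. Then `E_{0 ≤ x ≤ N-1} μ(x)χ(x) = O(e^{-c₂√log N})`.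

Printed proof: Perron/zero-free region give the bound for every modulus `q ≤ e^{c₂√log N}`
provided `L(s, χ)` has no exceptional zero (Montgomery–Vaughan §11.3, Exercise 11.3.7 with
Theorem 11.4); for `q = 2^t` there is no exceptional zero because the only non-principal real
primitive characters of 2-power conductor are `χ₄`, `χ₈`, `χ₄χ₈` ("any Dirichlet character of
conductor dividing `2^e` is determined by its values at `−1` and `5`").

Lean route (same architecture, using what the tree already proves):
* characters with `χ² ≠ 1`: the tree's Landau engine with an exceptional zero
  (`MoebiusTwist.exists_excPsiData_all` + `ExcPsiData.exists_psi_bound`, MV §11.3 Exercises 7–8),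
  whose exceptional term is present only for quadratic `χ ≠ χ₀`, is valid for `log q ≤ √log x`
  (`MoebiusDyadic.abs_re_twist_le_of_sq_ne_one`);
* real characters (`χ² = 1`) mod `2^t`, `t ≥ 3`: they factor through modulus `8`, because every
  unit `≡ 1 (mod 8)` is a square mod `2^t` (Hensel at `p = 2`, `MoebiusDyadic.exists_odd_sq_sub_dvd`,
  `MoebiusDyadic.factorsThrough_eight`) — this is the Lean form of Green's remark on `(ℤ/2^eℤ)^*` —
  and for moduli `≤ 8 ≤ (log x)^3` the PROVED Siegel–Walfisz-range bound
  `MoebiusCharacterSumBound_holds` (MV §11.3 Exercise 8) applies.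

Main results (each with its own absolute constants `c > 0`, `C ≥ 0`):
* `MoebiusDyadic.norm_sum_moebius_mul_character_twoPow_le` (Green's Theorem 3):
  `‖∑_{n ≤ x} μ(n)χ(n)‖ ≤ C x e^{-c√log x}` for `x ≥ 2`, `2^t ≤ e^{c√log x}`, `χ` mod `2^t`;
* `MoebiusDyadic.abs_sum_moebius_progression_twoPow_le` (progression form, all residues):
  `|∑_{n ≤ x, n ≡ a (2^t)} μ(n)| ≤ C x e^{-c√log x}`;
* `MoebiusDyadic.norm_afExpSum_moebius_twoPow_le` (Green's Corollary 1, all prefixes `X ≤ N`):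
  `‖∑_{n ≤ X} μ(n) e(na/2^t)‖ ≤ C N e^{-c√log N}` for `2^t ≤ e^{c√log N}`;
* `MoebiusDyadic.norm_afExpSum_moebius_near_twoPow_le` (Green's Corollary 2, all prefixes):
  the same for `e(nθ)`, `|θ − a/2^t| ≤ e^{c√log N}/N`.
These are the "major arc" inputs of Green's Proposition 3 (exponential sums over Möbius at sparse
dyadic rationals), itself the analytic heart of his Proposition 1 on the Walsh–Fourier
coefficients of `μ` (`Literature.Computability.Complexity.Green2012_moebius_walshCoeff`).

## References
* [Green2012] B. Green, CPC 21 (2012), §4 Theorem 3, Corollaries 1–2.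
* [MontgomeryVaughan2007] H. L. Montgomery, R. C. Vaughan, *Multiplicative Number Theory I*,
  §11.3 (Exercises 7, 8, 13).
-/

noncomputable section

open Complex Finset
open scoped ArithmeticFunction.Moebius

namespace Literature.NumberTheory.LFunctions

namespace MoebiusDyadic

open ClassicalPsiData MoebiusTwist

/-! ## Characters with `χ² ≠ 1`: the Landau engine without exceptional zero -/

/-- **The core estimate for non-real characters, any modulus with `log q ≤ √log x`** (MV §11.3
Exercises 7–8 via the tree's engine `ExcPsiData.exists_psi_bound` for `1 + λ Re(wχ(n))μ(n)`; the
exceptional pole is absent since it only occurs for quadratic `χ ≠ χ₀`): absolute `c' > 0`,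
`K, D ≥ 0` with `|Re(w ∑_{n ≤ x} χ(n)μ(n))| ≤ (K log 4q + 1)(D q² x e^{−c'√log x} + 1)` for all
`q ≥ 1`, `χ` mod `q` with `χ² ≠ 1`, `|w| ≤ 1`, `x ≥ 64`, `log q ≤ √log x`.
[cite: MontgomeryVaughan2007, §11.3 Exercises 7–8; Green2012, §4 proof of Theorem 3] -/
theorem abs_re_twist_le_of_sq_ne_one :
    ∃ c' : ℝ, 0 < c' ∧ c' ≤ 1 ∧ ∃ K : ℝ, 0 ≤ K ∧ ∃ D : ℝ, 0 ≤ D ∧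
      ∀ (q : ℕ) [NeZero q] (χ : DirichletCharacter ℂ q), χ ^ 2 ≠ 1 → ∀ w : ℂ, ‖w‖ ≤ 1 →
        ∀ x : ℝ, 64 ≤ x → Real.log q ≤ Real.sqrt (Real.log x) →
          |(w * ∑ n ∈ Finset.Ioc 0 ⌊x⌋₊, χ (n : ZMod q) * (μ n : ℂ)).re| ≤
            (K * (Real.log q + Real.log 4) + 1) *
              (D * (q : ℝ) ^ 2 * x * Real.exp (-(c' * Real.sqrt (Real.log x))) + 1) := by
  obtain ⟨c, hc, hc2, K, hK, C₀, hC₀, hdata⟩ := exists_excPsiData_all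
  obtain ⟨A₀, hA₀, hpsi⟩ := ExcPsiData.exists_psi_bound hc hc2
  refine ⟨c / 80, by positivity, by linarith, K, hK, A₀ * (C₀ + 1), by positivity,
    fun q _ χ hχ w hw x hx hlogq ↦ ?_⟩
  obtain ⟨β, α, F, hcase, hD⟩ := hdata q χ w hw
  have hα0 : α = 0 := by
    rcases hcase with h | ⟨_, h2, _⟩
    · exact h
    · exact absurd h2 hχ
  have hb := hpsi hD x hx hlogq
  rw [psi_coeff_eq, hα0] at hb
  set lam : ℝ := 1 / (K * (Real.log q + Real.log 4) + 1) with hlam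
  set S : ℂ := ∑ n ∈ Finset.Ioc 0 ⌊x⌋₊, χ (n : ZMod q) * (μ n : ℂ) with hSdef
  set E : ℝ := Real.exp (-(c / 80 * Real.sqrt (Real.log x))) with hEdef
  have hx0 : 0 < x := by linarith
  have hq1 : (1 : ℝ) ≤ q := by exact_mod_cast NeZero.one_le
  have hℒ₀ : 1 ≤ Real.log q + Real.log 4 := PagePNT.one_le_ell0 q
  have hden : 0 < K * (Real.log q + Real.log 4) + 1 := by positivity
  have hlam0 : 0 < lam := by rw [hlam]; positivity
  have hfloor : |(⌊x⌋₊ : ℝ) - x| ≤ 1 := by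
    rw [abs_sub_comm, abs_of_nonneg (sub_nonneg.2 (Nat.floor_le hx0.le))]
    exact (sub_lt_iff_lt_add.2 (by linarith [Nat.lt_floor_add_one x])).le
  have hkey : lam * |(w * S).re| ≤ A₀ * (C₀ * (q : ℝ) ^ 2 + 1) * x * E + 1 := by
    have heq : lam * (w * S).re =
        ((⌊x⌋₊ : ℝ) + lam * (w * S).re - (x - 0 * x ^ β / β)) + (x - (⌊x⌋₊ : ℝ)) := by ring
    rw [← abs_of_pos hlam0, ← abs_mul, heq]
    calc |((⌊x⌋₊ : ℝ) + lam * (w * S).re - (x - 0 * x ^ β / β)) + (x - (⌊x⌋₊ : ℝ))|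
        ≤ |(⌊x⌋₊ : ℝ) + lam * (w * S).re - (x - 0 * x ^ β / β)| + |x - (⌊x⌋₊ : ℝ)| :=
          abs_add_le _ _
      _ ≤ A₀ * (C₀ * (q : ℝ) ^ 2 + 1) * x * E + 1 := by
          refine add_le_add hb ?_
          rw [abs_sub_comm]; exact hfloor
  have hq2 : (1 : ℝ) ≤ (q : ℝ) ^ 2 := one_le_pow₀ hq1
  have hmono : A₀ * (C₀ * (q : ℝ) ^ 2 + 1) ≤ A₀ * (C₀ + 1) * (q : ℝ) ^ 2 := by
    have : A₀ * (C₀ + 1) * (q : ℝ) ^ 2 = A₀ * (C₀ * (q : ℝ) ^ 2 + (q : ℝ) ^ 2) := by ring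
    rw [this]
    exact mul_le_mul_of_nonneg_left (by linarith) hA₀.le
  have hxE : 0 ≤ x * E := by positivity
  calc |(w * S).re| = (K * (Real.log q + Real.log 4) + 1) * (lam * |(w * S).re|) := by
        rw [hlam]; field_simp
    _ ≤ (K * (Real.log q + Real.log 4) + 1) * (A₀ * (C₀ * (q : ℝ) ^ 2 + 1) * x * E + 1) :=
        mul_le_mul_of_nonneg_left hkey hden.le
    _ ≤ (K * (Real.log q + Real.log 4) + 1) * (A₀ * (C₀ + 1) * (q : ℝ) ^ 2 * x * E + 1) := by
        refine mul_le_mul_of_nonneg_left ?_ hden.le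
        have := mul_le_mul_of_nonneg_right hmono hxE
        nlinarith

/-! ## Real characters mod `2^t` factor through modulus `8` -/

/-- **Hensel at `2`**: if `m ≡ 1 (mod 8)` then for every `s` there is an odd `y` with
`2^{s+3} ∣ m − y²`; i.e. units `≡ 1 (mod 8)` are squares modulo every `2^t`, `t ≥ 3`
(Green: "`(ℤ/2^eℤ)^* ≅ {±1} × {1, 5, …, 5^{2^{e-2}-1}}`"). [cite: Green2012, §4 proof of Theorem 3] -/
theorem exists_odd_sq_sub_dvd {m : ℕ} (hm : m ≡ 1 [MOD 8]) (s : ℕ) :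
    ∃ y : ℕ, Odd y ∧ ((2 : ℤ) ^ (s + 3) ∣ (m : ℤ) - (y : ℤ) ^ 2) := by
  induction s with
  | zero =>
    refine ⟨1, odd_one, ?_⟩
    have h := (Nat.modEq_iff_dvd.1 hm.symm)
    simpa using h
  | succ s ih =>
    obtain ⟨y, hy, e, he⟩ := ih
    rcases Int.even_or_odd e with ⟨f, hf⟩ | ⟨f, hf⟩
    · refine ⟨y, hy, f, ?_⟩
      rw [he, hf]; ring
    · refine ⟨y + 2 ^ (s + 2), hy.add_even ((even_two.pow_of_ne_zero (by omega))), ?_⟩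
      obtain ⟨z, hz⟩ := hy
      -- `m − (y + 2^{s+2})² = 2^{s+3} e − 2^{s+3} y − 2^{2s+4}`, and `e − y` is even
      have : (m : ℤ) - ((y + 2 ^ (s + 2) : ℕ) : ℤ) ^ 2 =
          2 ^ (s + 1 + 3) * (f - (z : ℤ) - 2 ^ s) := by
        have h1 : (m : ℤ) = (y : ℤ) ^ 2 + 2 ^ (s + 3) * e := by linarith
        push_cast
        rw [h1, hf, hz]
        push_cast
        ring
      exact ⟨_, this⟩

/-- **Real characters of 2-power modulus factor through `8`**: for `t ≥ 3`, a Dirichlet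
character `χ` mod `2^t` with `χ² = 1` factors through modulus `8` (its kernel contains the units
`≡ 1 (mod 8)`, which are squares). This is the Lean form of Green's "there are only three
nonprincipal primitive real Dirichlet characters with conductor a power of two".
[cite: Green2012, §4 proof of Theorem 3] -/
theorem factorsThrough_eight {t : ℕ} (ht : 3 ≤ t) (χ : DirichletCharacter ℂ (2 ^ t))
    (hχ : χ ^ 2 = 1) : χ.FactorsThrough 8 := by
  have h8 : 8 ∣ 2 ^ t := by
    obtain ⟨s, rfl⟩ := Nat.exists_eq_add_of_le ht
    exact ⟨2 ^ s, by rw [pow_add]; norm_num⟩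
  haveI : NeZero (2 ^ t) := ⟨pow_ne_zero _ two_ne_zero⟩
  rw [DirichletCharacter.factorsThrough_iff_ker_unitsMap h8]
  intro u hu
  rw [MonoidHom.mem_ker] at hu ⊢
  -- `u ≡ 1 (mod 8)`
  set m : ℕ := (u : ZMod (2 ^ t)).val with hmdef
  have hum : ((m : ℕ) : ZMod (2 ^ t)) = (u : ZMod (2 ^ t)) := ZMod.natCast_zmod_val _
  have hm8 : m ≡ 1 [MOD 8] := by
    have h1 : ((ZMod.unitsMap h8 u : (ZMod 8)ˣ) : ZMod 8) = 1 := by rw [hu]; rfl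
    rw [ZMod.unitsMap_val, ZMod.cast_eq_val] at h1
    rw [← hmdef] at h1
    have h2 : ((m : ℕ) : ZMod 8) = ((1 : ℕ) : ZMod 8) := by rw [h1, Nat.cast_one]
    exact (ZMod.natCast_eq_natCast_iff _ _ _).1 h2
  obtain ⟨s, hs⟩ := Nat.exists_eq_add_of_le ht
  obtain ⟨y, hyodd, hdiv⟩ := exists_odd_sq_sub_dvd hm8 s
  have hts : 2 ^ t = 2 ^ (s + 3) := by rw [hs, add_comm]
  -- `y` is a unit mod `2^t` and `y² = u`
  have hycop : Nat.Coprime y (2 ^ t) :=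
    Nat.Coprime.pow_right _ (Nat.coprime_two_right.mpr hyodd)
  set v : (ZMod (2 ^ t))ˣ := ZMod.unitOfCoprime y hycop with hvdef
  have hv : (v : ZMod (2 ^ t)) = (y : ZMod (2 ^ t)) := ZMod.coe_unitOfCoprime y hycop
  have hsq : (u : ZMod (2 ^ t)) = (v : ZMod (2 ^ t)) ^ 2 := by
    rw [hv, ← hum]
    have h1 : ((2 ^ t : ℕ) : ℤ) ∣ (m : ℤ) - (y : ℤ) ^ 2 := by
      rw [hts]; push_cast; exact hdiv
    have h2 := (ZMod.intCast_eq_intCast_iff_dvd_sub ((y : ℤ) ^ 2) (m : ℤ) (2 ^ t)).2 h1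
    push_cast at h2
    exact h2.symm
  have huv : u = v ^ 2 := Units.ext (by rw [Units.val_pow_eq_pow_val]; exact hsq)
  rw [huv, map_pow]
  -- `χ(v)² = χ²(v) = 1`
  ext
  rw [Units.val_pow_eq_pow_val, MulChar.coe_toUnitHom, Units.val_one,
    ← MulChar.pow_apply_coe, hχ, MulChar.one_apply_coe]

/-! ## Green's Theorem 3: `‖∑_{n ≤ x} μ(n)χ(n)‖ ≤ C x e^{-c√log x}` for `χ` mod `2^t ≤ e^{c√log x}` -/

/-- The trivial bound `‖∑_{n ≤ N} μ(n)χ(n)‖ ≤ N`. [folklore] -/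
theorem norm_sum_moebius_mul_char_le {q : ℕ} (χ : DirichletCharacter ℂ q) (N : ℕ) :
    ‖∑ n ∈ Finset.Icc 1 N, (μ n : ℂ) * χ (n : ZMod q)‖ ≤ N := by
  calc ‖∑ n ∈ Finset.Icc 1 N, (μ n : ℂ) * χ (n : ZMod q)‖
      ≤ ∑ n ∈ Finset.Icc 1 N, ‖(μ n : ℂ) * χ (n : ZMod q)‖ := norm_sum_le _ _
    _ ≤ ∑ n ∈ Finset.Icc 1 N, (1 : ℝ) := by
        refine Finset.sum_le_sum fun n _ ↦ ?_
        rw [norm_mul, Complex.norm_intCast]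
        calc |(μ n : ℝ)| * ‖χ (n : ZMod q)‖ ≤ 1 * 1 := by
              gcongr
              · exact_mod_cast ArithmeticFunction.abs_moebius_le_one
              · exact DirichletCharacter.norm_le_one χ _
          _ = 1 := one_mul _
    _ = N := by rw [Finset.sum_const, Nat.card_Icc, nsmul_eq_mul, mul_one, Nat.add_sub_cancel]

/-- A character mod `2^t` (`t ≥ 1`) and a character mod `8` vanish at even arguments and, when the
former is the lift of the latter, agree at odd ones; hence the twisted Möbius sums coincide.
[folklore] -/
theorem sum_eq_sum_of_eq_changeLevel {t : ℕ} (ht : 1 ≤ t) {χ : DirichletCharacter ℂ (2 ^ t)}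
    {χ₈ : DirichletCharacter ℂ 8} (h8 : 8 ∣ 2 ^ t)
    (hχ : χ = DirichletCharacter.changeLevel h8 χ₈) (N : ℕ) :
    ∑ n ∈ Finset.Icc 1 N, (μ n : ℂ) * χ (n : ZMod (2 ^ t)) =
      ∑ n ∈ Finset.Icc 1 N, (μ n : ℂ) * χ₈ (n : ZMod 8) := by
  refine Finset.sum_congr rfl fun n _ ↦ ?_
  congr 1
  rcases Nat.even_or_odd n with hev | hodd
  · -- both vanish
    have h2t : ¬ Nat.Coprime n (2 ^ t) := by
      intro h
      have h2 : Nat.Coprime n 2 := h.coprime_dvd_right (dvd_pow_self 2 (by omega))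
      exact (Nat.not_even_iff_odd.2 (Nat.coprime_two_right.mp h2)) hev
    have h28 : ¬ Nat.Coprime n 8 := by
      intro h
      have h2 : Nat.Coprime n 2 := h.coprime_dvd_right (by norm_num)
      exact (Nat.not_even_iff_odd.2 (Nat.coprime_two_right.mp h2)) hev
    have hnu1 : ¬ IsUnit ((n : ℕ) : ZMod (2 ^ t)) :=
      fun h ↦ h2t ((ZMod.isUnit_iff_coprime n _).1 h)
    have hnu2 : ¬ IsUnit ((n : ℕ) : ZMod 8) := fun h ↦ h28 ((ZMod.isUnit_iff_coprime n 8).1 h)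
    rw [MulChar.map_nonunit _ hnu1, MulChar.map_nonunit _ hnu2]
  · have hcop : IsCoprime (n : ℤ) ((2 ^ t : ℕ) : ℤ) :=
      Nat.isCoprime_iff_coprime.2 ((Nat.coprime_two_right.mpr hodd).pow_right t)
    have h := DirichletCharacter.changeLevel_eq_cast_of_dvd' χ₈ h8 hcop
    rw [hχ]
    simpa using h

/-- `exp 2 ≤ 64` (so `log x ≥ 2` for `x ≥ 64`). [folklore] -/
theorem exp_two_le : Real.exp 2 ≤ 64 := by
  have h1 := Real.exp_one_lt_d9
  have h2 : Real.exp 2 = Real.exp 1 ^ 2 := by rw [← Real.exp_nat_mul]; norm_num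
  rw [h2]
  nlinarith [Real.exp_pos 1]

/-- `y e^{-a y} ≤ 1/a` for `a > 0` (any real `y`). [folklore] -/
theorem mul_exp_neg_le_inv {a : ℝ} (ha : 0 < a) (y : ℝ) :
    y * Real.exp (-(a * y)) ≤ 1 / a := by
  have h1 : a * y ≤ Real.exp (a * y) := by linarith [Real.add_one_le_exp (a * y)]
  rw [Real.exp_neg, le_div_iff₀ ha]
  have hE := Real.exp_pos (a * y)
  calc y * (Real.exp (a * y))⁻¹ * a = (a * y) / Real.exp (a * y) := by field_simp
    _ ≤ 1 := by rw [div_le_one hE]; exact h1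

set_option maxHeartbeats 400000 in
/-- **Green 2012, Theorem 3** (Möbius twisted by characters of 2-power modulus, beyond the
Siegel–Walfisz range): there are absolute `c > 0`, `C` such that for all `x ≥ 2`, all `t` with
`2^t ≤ e^{c√log x}` and all Dirichlet characters `χ` mod `2^t`,
`‖∑_{1 ≤ n ≤ x} μ(n)χ(n)‖ ≤ C x e^{−c√log x}`. (Green states it as
`E_{0 ≤ x ≤ N−1} μ(x)χ(x) = O(e^{−c₂√log N})` for `q = 2^t ≤ e^{c₂√log N}`.) Non-real `χ`: the
engine bound `abs_re_twist_le_of_sq_ne_one` (`log q ≤ c√log x ≤ √log x`, `q² ≤ e^{(c'/2)√log x}`);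
real `χ`: `factorsThrough_eight` and the proved Siegel–Walfisz-range bound
`MoebiusCharacterSumBound_holds` at modulus `≤ 8 ≤ (log x)³`. [cite: Green2012, §4 Theorem 3] -/
theorem norm_sum_moebius_mul_character_twoPow_le :
    ∃ c : ℝ, 0 < c ∧ c ≤ 1 ∧ ∃ C : ℝ, 0 ≤ C ∧ ∀ x : ℝ, 2 ≤ x → ∀ t : ℕ,
      (2 : ℝ) ^ t ≤ Real.exp (c * Real.sqrt (Real.log x)) → ∀ χ : DirichletCharacter ℂ (2 ^ t),
        ‖∑ n ∈ Finset.Icc 1 ⌊x⌋₊, (μ n : ℂ) * χ (n : ZMod (2 ^ t))‖ ≤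
          C * x * Real.exp (-(c * Real.sqrt (Real.log x))) := by
  obtain ⟨c', hc', hc'1, K, hK, D, hD, hcore⟩ := abs_re_twist_le_of_sq_ne_one
  obtain ⟨c₁, hc₁, hSW⟩ := MoebiusCharacterSumBound_holds
  obtain ⟨C₃, hC₃⟩ := hSW 3 (by norm_num)
  set c : ℝ := min (c' / 4) c₁ with hcdef
  have hc0 : 0 < c := lt_min (by positivity) hc₁
  have hcc' : c ≤ c' / 4 := min_le_left _ _
  have hcc₁ : c ≤ c₁ := min_le_right _ _
  have hc1 : c ≤ 1 := by linarith
  set Cbig : ℝ := 2 * ((4 * K + 1) * (D * (1 / (c' / 4)) + 1)) with hCbig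
  have hCbig0 : 0 ≤ Cbig := by positivity
  set C8 : ℝ := max C₃ 0 with hC8
  have hC80 : 0 ≤ C8 := le_max_right _ _
  set Csmall : ℝ := Real.exp (Real.sqrt (Real.log 64)) with hCsmall
  have hCsmall0 : 0 ≤ Csmall := (Real.exp_pos _).le
  refine ⟨c, hc0, hc1, Cbig + C8 + Csmall, by positivity, fun x hx t ht χ ↦ ?_⟩
  haveI : NeZero (2 ^ t) := ⟨pow_ne_zero _ two_ne_zero⟩
  have hx0 : 0 < x := by linarith
  set L : ℝ := Real.log x with hL
  have hL0 : 0 < L := Real.log_pos (by linarith)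
  set E : ℝ := Real.exp (-(c * Real.sqrt L)) with hEdef
  have hE0 : 0 < E := Real.exp_pos _
  set S : ℂ := ∑ n ∈ Finset.Icc 1 ⌊x⌋₊, (μ n : ℂ) * χ (n : ZMod (2 ^ t)) with hSdef
  have htriv : ‖S‖ ≤ x := (norm_sum_moebius_mul_char_le χ ⌊x⌋₊).trans (Nat.floor_le hx0.le)
  have hsqrtL0 : 0 ≤ Real.sqrt L := Real.sqrt_nonneg _
  -- `log 2^t ≤ c √L`
  have hlogq : Real.log ((2 ^ t : ℕ) : ℝ) ≤ c * Real.sqrt L := by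
    have h1 : ((2 ^ t : ℕ) : ℝ) = (2 : ℝ) ^ t := by push_cast; ring
    rw [h1]
    calc Real.log ((2 : ℝ) ^ t) ≤ Real.log (Real.exp (c * Real.sqrt L)) :=
          Real.log_le_log (by positivity) ht
      _ = c * Real.sqrt L := Real.log_exp _
  rcases lt_or_ge x 64 with hx64 | hx64
  · -- small `x`: trivial bound
    have hL64 : L ≤ Real.log 64 := Real.log_le_log hx0 hx64.le
    have h1 : 1 ≤ Csmall * E := by
      rw [hCsmall, hEdef, ← Real.exp_add]
      refine Real.one_le_exp ?_
      have h2 : Real.sqrt L ≤ Real.sqrt (Real.log 64) := Real.sqrt_le_sqrt hL64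
      have h3 : c * Real.sqrt L ≤ 1 * Real.sqrt L := mul_le_mul_of_nonneg_right hc1 hsqrtL0
      linarith
    calc ‖S‖ ≤ x := htriv
      _ ≤ x * (Csmall * E) := le_mul_of_one_le_right hx0.le h1
      _ = Csmall * x * E := by ring
      _ ≤ (Cbig + C8 + Csmall) * x * E := by
          have : 0 ≤ (Cbig + C8) * x * E := by positivity
          nlinarith
  -- large `x`
  have hL2 : 2 ≤ L := by
    rw [hL, ← Real.log_exp 2]
    exact Real.log_le_log (Real.exp_pos 2) (exp_two_le.trans hx64)
  have hL1 : 1 ≤ L := by linarith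
  have hsqrt1 : 1 ≤ Real.sqrt L := Real.one_le_sqrt.2 hL1
  have hL3 : (8 : ℝ) ≤ L ^ (3 : ℝ) := by
    rw [show (3 : ℝ) = ((3 : ℕ) : ℝ) by norm_num, Real.rpow_natCast]
    have h := pow_le_pow_left₀ (by norm_num) hL2 3
    norm_num at h
    exact h
  -- the Siegel–Walfisz-range bound at a modulus `q' ≤ 8`
  have hSWuse : ∀ (q' : ℕ), 1 ≤ q' → (q' : ℝ) ≤ 8 → ∀ ψ : DirichletCharacter ℂ q',
      ‖∑ n ∈ Finset.Icc 1 ⌊x⌋₊, (μ n : ℂ) * ψ (n : ZMod q')‖ ≤ C8 * x * E := by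
    intro q' hq' hq'8 ψ
    refine (hC₃ x hx q' hq' (hq'8.trans hL3) ψ).trans ?_
    have h1 : Real.exp (-c₁ * Real.sqrt (Real.log x)) ≤ E := by
      rw [hEdef]; refine Real.exp_le_exp.2 ?_
      rw [← hL]; nlinarith
    calc C₃ * x * Real.exp (-c₁ * Real.sqrt (Real.log x))
        ≤ C8 * x * Real.exp (-c₁ * Real.sqrt (Real.log x)) := by gcongr; exact le_max_left _ _
      _ ≤ C8 * x * E := mul_le_mul_of_nonneg_left h1 (by positivity)
  have hfinal_of : ‖S‖ ≤ C8 * x * E ∨ ‖S‖ ≤ Cbig * x * E →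
      ‖S‖ ≤ (Cbig + C8 + Csmall) * x * E := by
    intro h
    have h1 : 0 ≤ Cbig * x * E := by positivity
    have h2 : 0 ≤ C8 * x * E := by positivity
    have h3 : 0 ≤ Csmall * x * E := by positivity
    rcases h with h | h <;> nlinarith
  apply hfinal_of
  rcases lt_or_ge t 3 with ht3 | ht3
  · -- modulus `2^t ≤ 4`: Siegel–Walfisz range directly
    left
    refine hSWuse (2 ^ t) NeZero.one_le ?_ χ
    have : ((2 ^ t : ℕ) : ℝ) ≤ ((2 ^ 2 : ℕ) : ℝ) := by
      exact_mod_cast Nat.pow_le_pow_right (by norm_num) (by omega)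
    refine this.trans ?_
    norm_num
  by_cases hχ2 : χ ^ 2 = 1
  · -- real character: factors through `8`
    left
    obtain ⟨h8, χ₈, hχ₈⟩ := factorsThrough_eight ht3 χ hχ2
    rw [hSdef, sum_eq_sum_of_eq_changeLevel (by omega) h8 hχ₈]
    exact hSWuse 8 (by norm_num) (by norm_num) χ₈
  · -- non-real character: the engine
    right
    have hlogq' : Real.log ((2 ^ t : ℕ) : ℝ) ≤ Real.sqrt L := by
      refine hlogq.trans ?_
      calc c * Real.sqrt L ≤ 1 * Real.sqrt L := mul_le_mul_of_nonneg_right hc1 hsqrtL0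
        _ = Real.sqrt L := one_mul _
    have hB1 := hcore (2 ^ t) χ hχ2 1 (by simp) x hx64 hlogq'
    have hB2 := hcore (2 ^ t) χ hχ2 (-I) (by simp) x hx64 hlogq'
    set S' : ℂ := ∑ n ∈ Finset.Ioc 0 ⌊x⌋₊, χ (n : ZMod (2 ^ t)) * (μ n : ℂ) with hS'def
    have hSS' : S = S' := by
      have hIcc : Finset.Icc 1 ⌊x⌋₊ = Finset.Ioc 0 ⌊x⌋₊ := rfl
      rw [hSdef, hS'def, hIcc]
      exact Finset.sum_congr rfl fun n _ ↦ mul_comm _ _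
    rw [one_mul] at hB1
    have hre2 : (-I * S').re = S'.im := by simp
    rw [hre2] at hB2
    set E' : ℝ := Real.exp (-(c' * Real.sqrt (Real.log x))) with hE'
    set q : ℕ := 2 ^ t with hqdef
    set B : ℝ := (K * (Real.log q + Real.log 4) + 1) * (D * (q : ℝ) ^ 2 * x * E' + 1) with hBdef
    have hnormS : ‖S‖ ≤ 2 * B := by
      rw [hSS']
      calc ‖S'‖ ≤ |S'.re| + |S'.im| := Complex.norm_le_abs_re_add_abs_im S'
        _ ≤ B + B := add_le_add hB1 hB2
        _ = 2 * B := by ring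
    -- sizes
    have hlog4 : Real.log 4 ≤ 3 := by
      have := Real.log_le_sub_one_of_pos (by norm_num : (0 : ℝ) < 4); linarith
    have hfac1 : K * (Real.log q + Real.log 4) + 1 ≤ (4 * K + 1) * Real.sqrt L := by
      have h1 : Real.log q ≤ Real.sqrt L := hlogq'
      have h2 : Real.log 4 ≤ 3 * Real.sqrt L := by linarith
      have h3 : K * (Real.log q + Real.log 4) ≤ K * (4 * Real.sqrt L) :=
        mul_le_mul_of_nonneg_left (by linarith) hK
      nlinarith
    -- `q² E' ≤ F²`, `F = e^{-(c'/4)√L}`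
    set F : ℝ := Real.exp (-(c' / 4 * Real.sqrt L)) with hFdef
    have hF0 : 0 < F := Real.exp_pos _
    have hq2E : (q : ℝ) ^ 2 * E' ≤ F * F := by
      have hq0 : (0 : ℝ) < q := by positivity
      have h3 : c * Real.sqrt L ≤ c' / 4 * Real.sqrt L := mul_le_mul_of_nonneg_right hcc' hsqrtL0
      have hlogq2 : 2 * Real.log q ≤ c' / 2 * Real.sqrt L := by linarith
      have h1 : (q : ℝ) ^ 2 = Real.exp (2 * Real.log q) := by
        rw [show (2 : ℝ) * Real.log q = ((2 : ℕ) : ℝ) * Real.log q by norm_num, Real.exp_nat_mul,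
          Real.exp_log hq0]
      have h2 : F * F = Real.exp (-(c' / 2 * Real.sqrt L)) := by
        rw [hFdef, ← Real.exp_add]; congr 1; ring
      have h4 : E' = Real.exp (-(c' * Real.sqrt L)) := by rw [hE']
      rw [h1, h4, h2, ← Real.exp_add]
      exact Real.exp_le_exp.2 (by linarith)
    -- `√L F ≤ 4/c'` and `√L ≤ x F`
    have hsF : Real.sqrt L * F ≤ 1 / (c' / 4) := mul_exp_neg_le_inv (by positivity) (Real.sqrt L)
    have hsx : Real.sqrt L ≤ x * F := by
      rw [hFdef]; exact sqrt_log_le_mul_exp hx0 hL1 (by linarith)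
    have hFE : F ≤ E := by
      rw [hFdef, hEdef]
      refine Real.exp_le_exp.2 ?_
      have h3 : c * Real.sqrt L ≤ c' / 4 * Real.sqrt L := mul_le_mul_of_nonneg_right hcc' hsqrtL0
      linarith
    have hB : B ≤ (4 * K + 1) * (D * (1 / (c' / 4)) + 1) * x * E := by
      have h1 : B ≤ (4 * K + 1) * Real.sqrt L * (D * (q : ℝ) ^ 2 * x * E' + 1) := by
        rw [hBdef]
        refine mul_le_mul_of_nonneg_right hfac1 ?_
        positivity
      have h2 : Real.sqrt L * (D * (q : ℝ) ^ 2 * x * E' + 1) ≤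
          (D * (1 / (c' / 4)) + 1) * x * F := by
        have h4 : Real.sqrt L * ((q : ℝ) ^ 2 * E') ≤ Real.sqrt L * (F * F) :=
          mul_le_mul_of_nonneg_left hq2E hsqrtL0
        have h5 : Real.sqrt L * (F * F) = (Real.sqrt L * F) * F := by ring
        have h6 : (Real.sqrt L * F) * F ≤ (1 / (c' / 4)) * F :=
          mul_le_mul_of_nonneg_right hsF hF0.le
        calc Real.sqrt L * (D * (q : ℝ) ^ 2 * x * E' + 1)
            = D * x * (Real.sqrt L * ((q : ℝ) ^ 2 * E')) + Real.sqrt L := by ring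
          _ ≤ D * x * ((1 / (c' / 4)) * F) + x * F := by
              refine add_le_add ?_ hsx
              refine mul_le_mul_of_nonneg_left ?_ (by positivity)
              calc Real.sqrt L * ((q : ℝ) ^ 2 * E') ≤ Real.sqrt L * (F * F) := h4
                _ = (Real.sqrt L * F) * F := h5
                _ ≤ (1 / (c' / 4)) * F := h6
          _ = (D * (1 / (c' / 4)) + 1) * x * F := by ring
      calc B ≤ (4 * K + 1) * Real.sqrt L * (D * (q : ℝ) ^ 2 * x * E' + 1) := h1
        _ = (4 * K + 1) * (Real.sqrt L * (D * (q : ℝ) ^ 2 * x * E' + 1)) := by ring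
        _ ≤ (4 * K + 1) * ((D * (1 / (c' / 4)) + 1) * x * F) :=
            mul_le_mul_of_nonneg_left h2 (by positivity)
        _ ≤ (4 * K + 1) * ((D * (1 / (c' / 4)) + 1) * x * E) := by
            refine mul_le_mul_of_nonneg_left ?_ (by positivity)
            exact mul_le_mul_of_nonneg_left hFE (by positivity)
        _ = (4 * K + 1) * (D * (1 / (c' / 4)) + 1) * x * E := by ring
    calc ‖S‖ ≤ 2 * B := hnormS
      _ ≤ 2 * ((4 * K + 1) * (D * (1 / (c' / 4)) + 1) * x * E) :=
          mul_le_mul_of_nonneg_left hB (by norm_num)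
      _ = Cbig * x * E := by rw [hCbig]; ring

/-! ## Möbius in progressions to 2-power moduli (all residues) -/

open MoebiusProgression in
set_option maxHeartbeats 800000 in
/-- **Möbius in arithmetic progressions to 2-power moduli up to `e^{c√log x}`** (the progression
form of Green's Theorem 3, obtained from it exactly as MV §11.3 Exercise 13 is obtained from
Exercise 8 in the tree's `SiegelWalfiszMoebius.of_characterSumBound`: gcd reduction
`sum_moebius_residue_eq` and the character expansion `abs_sum_coprime_progression_le`): absolute
`c > 0`, `C` with `|∑_{n ≤ x, n ≡ a (2^t)} μ(n)| ≤ C x e^{−c√log x}` for all `x ≥ 2`,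
`2^t ≤ e^{c√log x}` and every residue `a` mod `2^t`.
[cite: Green2012, §4 Theorem 3 and Corollary 1; MontgomeryVaughan2007, §11.3 Exercise 13] -/
theorem abs_sum_moebius_progression_twoPow_le :
    ∃ c : ℝ, 0 < c ∧ c ≤ 1 ∧ ∃ C : ℝ, 0 ≤ C ∧ ∀ x : ℝ, 2 ≤ x → ∀ t : ℕ,
      (2 : ℝ) ^ t ≤ Real.exp (c * Real.sqrt (Real.log x)) → ∀ a : ZMod (2 ^ t),
        |∑ n ∈ (Finset.Icc 1 ⌊x⌋₊).filter (fun n : ℕ ↦ (n : ZMod (2 ^ t)) = a), (μ n : ℝ)| ≤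
          C * x * Real.exp (-(c * Real.sqrt (Real.log x))) := by
  obtain ⟨c₁, hc₁, hc₁1, C₁, hC₁0, hchar⟩ := norm_sum_moebius_mul_character_twoPow_le
  set c : ℝ := c₁ / 2 with hcdef
  have hc0 : 0 < c := by positivity
  set Csmall : ℝ := Real.exp (c * Real.sqrt 4) with hCsmall
  refine ⟨c, hc0, by linarith, C₁ + Csmall, by positivity, fun x hx t ht a ↦ ?_⟩
  haveI : NeZero (2 ^ t) := ⟨pow_ne_zero _ two_ne_zero⟩
  have hq : 1 ≤ 2 ^ t := NeZero.one_le
  have hx0 : 0 < x := by linarith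
  set L : ℝ := Real.log x with hL
  have hL0 : 0 < L := Real.log_pos (by linarith)
  set E : ℝ := Real.exp (-(c * Real.sqrt L)) with hEdef
  have hE0 : 0 < E := Real.exp_pos _
  set N : ℕ := ⌊x⌋₊ with hN
  have hqexp : ((2 ^ t : ℕ) : ℝ) ≤ Real.exp (c * Real.sqrt L) := by
    have h1 : ((2 ^ t : ℕ) : ℝ) = (2 : ℝ) ^ t := by push_cast; ring
    rw [h1]; exact ht
  -- the decomposition `a₀ = d b`, `(2 ^ t) = d r`
  set a₀ : ℕ := a.val with ha₀def
  have ha : ((a₀ : ℕ) : ZMod (2 ^ t)) = a := ZMod.natCast_zmod_val a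
  set d : ℕ := Nat.gcd a₀ (2 ^ t) with hddef
  have hd0 : 0 < d := Nat.gcd_pos_of_pos_right _ (by positivity)
  obtain ⟨r, hqr⟩ : d ∣ (2 ^ t) := Nat.gcd_dvd_right a₀ (2 ^ t)
  obtain ⟨b, hab⟩ : d ∣ a₀ := Nat.gcd_dvd_left a₀ (2 ^ t)
  have hr0 : 0 < r := by
    rcases Nat.eq_zero_or_pos r with h0 | h0
    · exfalso; rw [h0, mul_zero] at hqr; exact (NeZero.ne (2 ^ t)) hqr
    · exact h0
  haveI : NeZero r := ⟨hr0.ne'⟩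
  have hbr : Nat.Coprime b r := by
    have h1 : Nat.gcd a₀ (2 ^ t) = d * Nat.gcd b r := by
      conv_lhs => rw [hab, hqr]
      exact Nat.gcd_mul_left d b r
    rw [← hddef] at h1
    have : d * Nat.gcd b r = d * 1 := by rw [← h1, mul_one]
    exact Nat.eq_of_mul_eq_mul_left hd0 this
  have hrq : r ∣ (2 ^ t) := ⟨d, by rw [hqr, mul_comm]⟩
  have hdqN : d ≤ 2 ^ t := Nat.le_of_dvd (by positivity) ⟨r, hqr⟩
  have hdq : (d : ℝ) ≤ (2 : ℝ) ^ t := by exact_mod_cast hdqN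
  have hd1 : (1 : ℝ) ≤ d := by exact_mod_cast hd0
  -- the identity
  have hident := sum_moebius_residue_eq hd0 hqr hab hbr ha N
  rw [hident]
  set T : ℝ := ∑ m ∈ (Finset.Icc 1 (N / d)).filter
      (fun m : ℕ ↦ m ≡ b [MOD r] ∧ Nat.Coprime m (2 ^ t)), (μ m : ℝ) with hT
  have hμd : |(μ d : ℝ)| ≤ 1 := by exact_mod_cast ArithmeticFunction.abs_moebius_le_one
  have hTtriv : |T| ≤ x := by
    calc |T| ≤ ∑ m ∈ (Finset.Icc 1 (N / d)).filter
          (fun m : ℕ ↦ m ≡ b [MOD r] ∧ Nat.Coprime m (2 ^ t)), |(μ m : ℝ)| :=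
          Finset.abs_sum_le_sum_abs _ _
      _ ≤ ∑ m ∈ (Finset.Icc 1 (N / d)).filter
          (fun m : ℕ ↦ m ≡ b [MOD r] ∧ Nat.Coprime m (2 ^ t)), (1 : ℝ) :=
          Finset.sum_le_sum fun m _ ↦ by exact_mod_cast ArithmeticFunction.abs_moebius_le_one
      _ = ((Finset.Icc 1 (N / d)).filter (fun m : ℕ ↦ m ≡ b [MOD r] ∧ Nat.Coprime m (2 ^ t))).card := by
          rw [Finset.sum_const, nsmul_eq_mul, mul_one]
      _ ≤ (Finset.Icc 1 (N / d)).card := by exact_mod_cast Finset.card_filter_le _ _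
      _ = (N / d : ℕ) := by rw [Nat.card_Icc]; simp
      _ ≤ N := by exact_mod_cast Nat.div_le_self N d
      _ ≤ x := Nat.floor_le hx0.le
  have habsprod : |(μ d : ℝ) * T| ≤ |T| := by
    rw [abs_mul]; exact mul_le_of_le_one_left (abs_nonneg _) hμd
  rcases lt_or_ge L 4 with hLU | hLU
  · -- small `x`
    have h1 : 1 ≤ Csmall * E := by
      rw [hCsmall, hEdef, ← Real.exp_add]
      refine Real.one_le_exp ?_
      have : Real.sqrt L ≤ Real.sqrt 4 := Real.sqrt_le_sqrt hLU.le
      nlinarith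
    calc |(μ d : ℝ) * T| ≤ |T| := habsprod
      _ ≤ x := hTtriv
      _ ≤ x * (Csmall * E) := le_mul_of_one_le_right hx0.le h1
      _ ≤ (C₁ + Csmall) * x * E := by
          have : 0 ≤ C₁ * x * E := by positivity
          nlinarith
  · -- large `x`: Theorem 3 at `y = x/d` for the lifted characters mod `(2 ^ t)`
    have hL1 : 1 ≤ L := by linarith
    have hsqrt1 : 1 ≤ Real.sqrt L := Real.one_le_sqrt.2 hL1
    have hq0 : (0 : ℝ) < (2 : ℝ) ^ t := by positivity
    -- `log d ≤ log (2 ^ t) ≤ c√L ≤ L/2`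
    have hlogq : Real.log ((2 : ℝ) ^ t) ≤ c * Real.sqrt L := by
      calc Real.log ((2 : ℝ) ^ t) ≤ Real.log (Real.exp (c * Real.sqrt L)) := Real.log_le_log hq0 ht
        _ = c * Real.sqrt L := Real.log_exp _
    have hlogd : Real.log d ≤ L / 2 := by
      have h1 : Real.log d ≤ Real.log ((2 : ℝ) ^ t) := Real.log_le_log (by linarith) hdq
      have h2 : c * Real.sqrt L ≤ 1 / 2 * Real.sqrt L :=
        mul_le_mul_of_nonneg_right (by linarith) (Real.sqrt_nonneg L)
      have h3 : Real.sqrt L ≤ L := by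
        have hs := Real.sq_sqrt hL0.le
        nlinarith
      linarith
    set y : ℝ := x / d with hy
    have hd0' : (0 : ℝ) < d := by linarith
    have hy0 : 0 < y := div_pos hx0 hd0'
    have hlogy : Real.log y = L - Real.log d := by rw [hy, Real.log_div hx0.ne' hd0'.ne']
    have hlogy2 : L / 2 ≤ Real.log y := by rw [hlogy]; linarith
    have hlogy1 : 2 ≤ Real.log y := by linarith
    have hy2 : 2 ≤ y := by
      have h1 : Real.exp 2 ≤ Real.exp (Real.log y) := Real.exp_le_exp.2 hlogy1
      rw [Real.exp_log hy0] at h1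
      have h2 : (2 : ℝ) ≤ Real.exp 2 := by linarith [Real.add_one_le_exp (2 : ℝ)]
      linarith
    have hyx : y ≤ x := div_le_self hx0.le hd1
    -- `√L/2 ≤ √log y`, so `2^t ≤ e^{c√L} ≤ e^{c₁√log y}`
    have hsqrt : Real.sqrt L / 2 ≤ Real.sqrt (Real.log y) := by
      rw [Real.le_sqrt (by positivity) (by linarith)]
      have := Real.sq_sqrt hL0.le
      nlinarith
    have hc₁sqrt : c₁ * (Real.sqrt L / 2) ≤ c₁ * Real.sqrt (Real.log y) :=
      mul_le_mul_of_nonneg_left hsqrt hc₁.le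
    have hty : (2 : ℝ) ^ t ≤ Real.exp (c₁ * Real.sqrt (Real.log y)) := by
      refine ht.trans (Real.exp_le_exp.2 ?_)
      rw [hcdef]
      linarith
    have hNd : N / d = ⌊y⌋₊ := by rw [hy, hN, Nat.floor_div_natCast]
    have hB : ∀ χ : DirichletCharacter ℂ r,
        ‖∑ m ∈ Finset.Icc 1 (N / d), (μ m : ℂ) *
          DirichletCharacter.changeLevel hrq χ (m : ZMod (2 ^ t))‖ ≤
            C₁ * y * Real.exp (-(c₁ * Real.sqrt (Real.log y))) := by
      intro χ
      rw [hNd]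
      exact hchar y hy2 t hty (DirichletCharacter.changeLevel hrq χ)
    have hTb := abs_sum_coprime_progression_le hrq hbr (N / d) hB
    -- `y e^{−c₁√log y} ≤ x E`
    have hexp : Real.exp (-(c₁ * Real.sqrt (Real.log y))) ≤ E := by
      rw [hEdef]
      refine Real.exp_le_exp.2 ?_
      rw [hcdef]
      linarith
    calc |(μ d : ℝ) * T| ≤ |T| := habsprod
      _ ≤ C₁ * y * Real.exp (-(c₁ * Real.sqrt (Real.log y))) := hTb
      _ ≤ C₁ * x * E := by
          refine mul_le_mul (mul_le_mul_of_nonneg_left hyx hC₁0) hexp (Real.exp_pos _).le ?_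
          positivity
      _ ≤ (C₁ + Csmall) * x * E := by
          have : 0 ≤ Csmall * x * E := by positivity
          nlinarith

/-! ## Corollary 1: additive characters at dyadic rationals `a/2^t` -/

section Additive

open Literature.NumberTheory.Sieve.Vinogradov (afExpSum norm_afExpSum_le norm_fourierChar
  norm_fourierChar_sub_one)
open Literature.NumberTheory.Sieve.RamanujanSum (fourierChar_intCast)
open Literature.NumberTheory.Sieve.FejerCounting (fourierChar_add_intCast)
open scoped FourierTransform

/-- The trivial bound `‖∑_{n ≤ X} μ(n) e(nα)‖ ≤ X`. [folklore] -/
theorem norm_afExpSum_moebius_le (X : ℕ) (α : ℝ) :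
    ‖afExpSum (fun n ↦ (μ n : ℝ)) X α‖ ≤ X := by
  refine (norm_afExpSum_le _ X α).trans ?_
  calc ∑ n ∈ Icc 1 X, |((μ n : ℝ))| ≤ ∑ n ∈ Icc 1 X, (1 : ℝ) :=
        Finset.sum_le_sum fun n _ ↦ by exact_mod_cast ArithmeticFunction.abs_moebius_le_one
    _ = X := by simp

/-- `e(na/q)` only depends on `n mod q`: if `n ≡ b (mod q)` then `e(na/q) = e(ba/q)`. [folklore] -/
theorem fourierChar_div_eq_of_natCast_eq {q : ℕ} [NeZero q] (a : ℤ) {n : ℕ} {b : ZMod q}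
    (hn : (n : ZMod q) = b) :
    (𝐞 ((n : ℝ) * ((a : ℝ) / q)) : ℂ) = 𝐞 ((b.val : ℝ) * ((a : ℝ) / q)) := by
  have h1 : ((b.val : ℤ) : ZMod q) = ((n : ℤ) : ZMod q) := by
    push_cast; rw [ZMod.natCast_zmod_val, hn]
  obtain ⟨k, hk⟩ := (ZMod.intCast_eq_intCast_iff_dvd_sub _ _ _).1 h1
  have hq : (q : ℝ) ≠ 0 := by exact_mod_cast NeZero.ne q
  have h2 : (n : ℝ) * ((a : ℝ) / q) = (b.val : ℝ) * ((a : ℝ) / q) + ((k * a : ℤ) : ℝ) := by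
    have h3 : (n : ℝ) = (b.val : ℝ) + (q : ℝ) * k := by
      have h4 : ((n : ℤ) : ℝ) = ((b.val : ℤ) : ℝ) + ((q : ℤ) * k : ℤ) := by
        rw [← hk]; push_cast; ring
      push_cast at h4
      exact h4
    rw [h3]; push_cast; field_simp
  rw [h2, fourierChar_add_intCast]

/-- Grouping `∑_{n ≤ X} μ(n) e(na/q)` by residues mod `q`. [folklore] -/
theorem afExpSum_div_eq_sum_residues (q : ℕ) [NeZero q] (a : ℤ) (X : ℕ) :
    afExpSum (fun n ↦ (μ n : ℝ)) X ((a : ℝ) / q) =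
      ∑ b : ZMod q, (𝐞 ((b.val : ℝ) * ((a : ℝ) / q)) : ℂ) *
        ((∑ n ∈ (Icc 1 X).filter (fun n : ℕ ↦ (n : ZMod q) = b), (μ n : ℝ) : ℝ) : ℂ) := by
  unfold afExpSum
  rw [← Finset.sum_fiberwise (Icc 1 X) (fun n : ℕ ↦ (n : ZMod q))]
  refine Finset.sum_congr rfl fun b _ ↦ ?_
  push_cast
  rw [Finset.mul_sum]
  refine Finset.sum_congr rfl fun n hn ↦ ?_
  rw [Finset.mem_filter] at hn
  rw [fourierChar_div_eq_of_natCast_eq a hn.2]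
  ring

/-- `√L ≤ (L + 1)/2`. [folklore] -/
theorem sqrt_le_add_one_half {L : ℝ} (hL : 0 ≤ L) : Real.sqrt L ≤ (L + 1) / 2 := by
  have hs := Real.sq_sqrt hL
  nlinarith [sq_nonneg (Real.sqrt L - 1), Real.sqrt_nonneg L]

/-- **Green 2012, Corollary 1** (Möbius against additive characters at dyadic rationals, uniformly
over prefixes): absolute `c > 0`, `C` such that for all `N ≥ 2`, all `t` with
`2^t ≤ e^{c√log N}`, all integers `a` and all `X ≤ N`,
`‖∑_{1 ≤ n ≤ X} μ(n) e(na/2^t)‖ ≤ C N e^{−c√log N}`. (Green: "`E_{0≤x≤N−1} μ(x)e(ax/2^t) =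
O(e^{−c₃√log N})` uniformly for `2^t ≤ e^{c₃√log N}` and `a ∈ ℤ`"; he expands over characters of
`(ℤ/2^tℤ)^*` on odd `x` and uses `μ(2x) = −μ(x)`; here we group by ALL residues mod `2^t` and use
the progression form `abs_sum_moebius_progression_twoPow_le`, which covers non-coprime residues.)
[cite: Green2012, §4 Corollary 1] -/
theorem norm_afExpSum_moebius_twoPow_le :
    ∃ c : ℝ, 0 < c ∧ c ≤ 1 ∧ ∃ C : ℝ, 0 ≤ C ∧ ∀ N : ℕ, 2 ≤ N → ∀ t : ℕ,
      (2 : ℝ) ^ t ≤ Real.exp (c * Real.sqrt (Real.log N)) → ∀ (a : ℤ) (X : ℕ), X ≤ N →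
        ‖afExpSum (fun n ↦ (μ n : ℝ)) X ((a : ℝ) / 2 ^ t)‖ ≤
          C * N * Real.exp (-(c * Real.sqrt (Real.log N))) := by
  obtain ⟨c₂, hc₂, hc₂1, C₂, hC₂0, hprog⟩ := abs_sum_moebius_progression_twoPow_le
  set c : ℝ := c₂ / 4 with hcdef
  have hc0 : 0 < c := by positivity
  have hc4 : c ≤ 1 / 4 := by rw [hcdef]; linarith
  refine ⟨c, hc0, by linarith, C₂ + 3, by positivity, fun N hN t ht a X hXN ↦ ?_⟩
  haveI : NeZero (2 ^ t) := ⟨pow_ne_zero _ two_ne_zero⟩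
  have hN0 : (0 : ℝ) < N := by exact_mod_cast (show 0 < N by omega)
  have hN2 : (2 : ℝ) ≤ N := by exact_mod_cast hN
  set L : ℝ := Real.log N with hL
  have hL0 : 0 < L := Real.log_pos (by linarith)
  set E : ℝ := Real.exp (-(c * Real.sqrt L)) with hEdef
  have hE0 : 0 < E := Real.exp_pos _
  have hsqrtL0 : 0 ≤ Real.sqrt L := Real.sqrt_nonneg L
  have hXR : (X : ℝ) ≤ N := by exact_mod_cast hXN
  -- the trivial regime `log X < L/2`
  have htriv : ‖afExpSum (fun n ↦ (μ n : ℝ)) X ((a : ℝ) / 2 ^ t)‖ ≤ X :=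
    norm_afExpSum_moebius_le X _
  have hsmall : Real.exp (L / 2) ≤ 3 * N * E := by
    -- `e^{L/2} ≤ 3 e^{L - c√L}` since `c√L ≤ (L+1)/8 ≤ L/2 + log 3`
    have h3 : (1 : ℝ) ≤ Real.log 3 := by
      rw [← Real.log_exp 1]
      refine Real.log_le_log (Real.exp_pos 1) ?_
      have := Real.exp_one_lt_d9; linarith
    have hNexp : (N : ℝ) = Real.exp L := by rw [hL, Real.exp_log hN0]
    have h3exp : (3 : ℝ) = Real.exp (Real.log 3) := by rw [Real.exp_log (by norm_num)]
    rw [hNexp, h3exp, hEdef, ← Real.exp_add, ← Real.exp_add]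
    refine Real.exp_le_exp.2 ?_
    have h1 : c * Real.sqrt L ≤ 1 / 4 * Real.sqrt L := mul_le_mul_of_nonneg_right hc4 hsqrtL0
    have h2 := sqrt_le_add_one_half hL0.le
    linarith
  by_cases hlogX : Real.log X < L / 2
  · have hXle : (X : ℝ) ≤ Real.exp (L / 2) := by
      rcases Nat.eq_zero_or_pos X with h0 | h0
      · rw [h0]; simp [Real.exp_nonneg]
      · have hX0 : (0 : ℝ) < X := by exact_mod_cast h0
        calc (X : ℝ) = Real.exp (Real.log X) := (Real.exp_log hX0).symm
          _ ≤ Real.exp (L / 2) := Real.exp_le_exp.2 hlogX.le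
    calc ‖afExpSum (fun n ↦ (μ n : ℝ)) X ((a : ℝ) / 2 ^ t)‖ ≤ X := htriv
      _ ≤ 3 * N * E := hXle.trans hsmall
      _ ≤ (C₂ + 3) * N * E := by
          have : 0 ≤ C₂ * N * E := by positivity
          nlinarith
  -- main regime: `log X ≥ L/2`, so `X ≥ 2`
  push Not at hlogX
  have hlogX0 : 0 < Real.log X := by linarith
  have hX1 : (1 : ℝ) < X := by
    by_contra h
    push Not at h
    have := Real.log_nonpos (Nat.cast_nonneg X) h
    linarith
  have hX2 : (2 : ℝ) ≤ X := by
    have : 1 < X := by exact_mod_cast hX1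
    exact_mod_cast this
  have hX0 : (0 : ℝ) < X := by linarith
  -- `√L/2 ≤ √log X`
  have hsqrt : Real.sqrt L / 2 ≤ Real.sqrt (Real.log X) := by
    rw [Real.le_sqrt (by positivity) hlogX0.le]
    have := Real.sq_sqrt hL0.le
    nlinarith
  have hc₂sqrt : c₂ * (Real.sqrt L / 2) ≤ c₂ * Real.sqrt (Real.log X) :=
    mul_le_mul_of_nonneg_left hsqrt hc₂.le
  have htX : (2 : ℝ) ^ t ≤ Real.exp (c₂ * Real.sqrt (Real.log X)) := by
    refine ht.trans (Real.exp_le_exp.2 ?_)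
    rw [hcdef]
    nlinarith
  have hfloor : ⌊(X : ℝ)⌋₊ = X := Nat.floor_natCast X
  have hres : ∀ b : ZMod (2 ^ t),
      |∑ n ∈ (Icc 1 X).filter (fun n : ℕ ↦ (n : ZMod (2 ^ t)) = b), (μ n : ℝ)| ≤
        C₂ * X * Real.exp (-(c₂ * Real.sqrt (Real.log X))) := by
    intro b
    have h := hprog X hX2 t htX b
    rwa [hfloor] at h
  -- sum over residues
  have hq : ((Fintype.card (ZMod (2 ^ t)) : ℕ) : ℝ) = (2 : ℝ) ^ t := by
    rw [ZMod.card]; push_cast; ring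
  have hcast : ((a : ℝ) / 2 ^ t) = ((a : ℝ) / ((2 ^ t : ℕ) : ℝ)) := by push_cast; ring
  rw [hcast, afExpSum_div_eq_sum_residues (2 ^ t) a X]
  have hexpX : Real.exp (-(c₂ * Real.sqrt (Real.log X))) ≤ Real.exp (-(c₂ / 2 * Real.sqrt L)) :=
    Real.exp_le_exp.2 (by linarith)
  calc ‖∑ b : ZMod (2 ^ t), (𝐞 ((b.val : ℝ) * ((a : ℝ) / ((2 ^ t : ℕ) : ℝ))) : ℂ) *
        ((∑ n ∈ (Icc 1 X).filter (fun n : ℕ ↦ (n : ZMod (2 ^ t)) = b), (μ n : ℝ) : ℝ) : ℂ)‖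
      ≤ ∑ b : ZMod (2 ^ t), ‖(𝐞 ((b.val : ℝ) * ((a : ℝ) / ((2 ^ t : ℕ) : ℝ))) : ℂ) *
        ((∑ n ∈ (Icc 1 X).filter (fun n : ℕ ↦ (n : ZMod (2 ^ t)) = b), (μ n : ℝ) : ℝ) : ℂ)‖ :=
        norm_sum_le _ _
    _ ≤ ∑ _b : ZMod (2 ^ t), C₂ * X * Real.exp (-(c₂ * Real.sqrt (Real.log X))) := by
        refine Finset.sum_le_sum fun b _ ↦ ?_
        rw [norm_mul, norm_fourierChar, one_mul, Complex.norm_real, Real.norm_eq_abs]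
        exact hres b
    _ = (2 : ℝ) ^ t * (C₂ * X * Real.exp (-(c₂ * Real.sqrt (Real.log X)))) := by
        rw [Finset.sum_const, Finset.card_univ, nsmul_eq_mul, hq]
    _ ≤ Real.exp (c * Real.sqrt L) * (C₂ * N * Real.exp (-(c₂ / 2 * Real.sqrt L))) := by
        refine mul_le_mul ht ?_ (by positivity) (Real.exp_pos _).le
        exact mul_le_mul (mul_le_mul_of_nonneg_left hXR hC₂0) hexpX (Real.exp_pos _).le
          (by positivity)
    _ = C₂ * N * E := by
        rw [hEdef, hcdef]
        have : Real.exp (c₂ / 4 * Real.sqrt L) * Real.exp (-(c₂ / 2 * Real.sqrt L)) =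
            Real.exp (-(c₂ / 4 * Real.sqrt L)) := by
          rw [← Real.exp_add]; congr 1; ring
        calc Real.exp (c₂ / 4 * Real.sqrt L) * (C₂ * N * Real.exp (-(c₂ / 2 * Real.sqrt L)))
            = C₂ * N * (Real.exp (c₂ / 4 * Real.sqrt L) * Real.exp (-(c₂ / 2 * Real.sqrt L))) := by
              ring
          _ = C₂ * N * Real.exp (-(c₂ / 4 * Real.sqrt L)) := by rw [this]
    _ ≤ (C₂ + 3) * N * E := by
        have : 0 ≤ 3 * N * E := by positivity
        nlinarith

/-! ## Corollary 2: `θ` near a dyadic rational with small denominator -/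

/-- `|e(β) − 1| ≤ 2π|β|`. [folklore] -/
theorem norm_fourierChar_sub_one_le (β : ℝ) : ‖(𝐞 β : ℂ) - 1‖ ≤ 2 * Real.pi * |β| := by
  rw [norm_fourierChar_sub_one]
  calc 2 * |Real.sin (Real.pi * β)| ≤ 2 * |Real.pi * β| :=
        mul_le_mul_of_nonneg_left Real.abs_sin_le_abs (by norm_num)
    _ = 2 * Real.pi * |β| := by rw [abs_mul, abs_of_pos Real.pi_pos]; ring

/-- Prefix sums over `range (m+1)` of `g` with `g 0 = 0` are the sums over `Icc 1 m`. [folklore] -/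
theorem sum_range_succ_eq_sum_Icc {g : ℕ → ℂ} (hg : g 0 = 0) (m : ℕ) :
    ∑ i ∈ Finset.range (m + 1), g i = ∑ i ∈ Icc 1 m, g i := by
  rw [Finset.range_eq_Ico]
  have : Finset.Ico 0 (m + 1) = insert 0 (Icc 1 m) := by
    ext i; simp only [Finset.mem_Ico, Finset.mem_insert, Finset.mem_Icc]; omega
  rw [this, Finset.sum_insert (by simp), hg, zero_add]

/-- **Green 2012, Corollary 2** (Möbius exponential sums near a dyadic rational with small
denominator, uniformly over prefixes): absolute `c > 0`, `C` such that for all `N ≥ 2`, `t` with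
`2^t ≤ e^{c√log N}`, integers `a` and reals `θ` with `|θ − a/2^t| ≤ e^{c√log N}/N`, and all
`X ≤ N`: `‖∑_{1 ≤ n ≤ X} μ(n) e(nθ)‖ ≤ C N e^{−c√log N}`. (Green splits into blocks of length
`L = Ne^{−2c₄√log N}`; we use partial summation against `e(nβ)`, `β = θ − a/2^t`, and Corollary 1
for all prefixes, which gives the same conclusion.) [cite: Green2012, §4 Corollary 2] -/
theorem norm_afExpSum_moebius_near_twoPow_le :
    ∃ c : ℝ, 0 < c ∧ c ≤ 1 ∧ ∃ C : ℝ, 0 ≤ C ∧ ∀ N : ℕ, 2 ≤ N → ∀ t : ℕ,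
      (2 : ℝ) ^ t ≤ Real.exp (c * Real.sqrt (Real.log N)) → ∀ (a : ℤ) (θ : ℝ),
        |θ - (a : ℝ) / 2 ^ t| ≤ Real.exp (c * Real.sqrt (Real.log N)) / N → ∀ X : ℕ, X ≤ N →
        ‖afExpSum (fun n ↦ (μ n : ℝ)) X θ‖ ≤
          C * N * Real.exp (-(c * Real.sqrt (Real.log N))) := by
  obtain ⟨c₃, hc₃, hc₃1, C₃, hC₃0, hadd⟩ := norm_afExpSum_moebius_twoPow_le
  set c : ℝ := c₃ / 2 with hcdef
  have hc0 : 0 < c := by positivity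
  refine ⟨c, hc0, by linarith, 8 * C₃, by positivity, fun N hN t ht a θ hθ X hXN ↦ ?_⟩
  have hN0 : (0 : ℝ) < N := by exact_mod_cast (show 0 < N by omega)
  have hN2 : (2 : ℝ) ≤ N := by exact_mod_cast hN
  set L : ℝ := Real.log N with hL
  have hL0 : 0 < L := Real.log_pos (by linarith)
  have hsqrtL0 : 0 ≤ Real.sqrt L := Real.sqrt_nonneg L
  set β : ℝ := θ - (a : ℝ) / 2 ^ t with hβdef
  set Q : ℝ := Real.exp (c * Real.sqrt L) with hQdef
  have hQ1 : 1 ≤ Q := Real.one_le_exp (by positivity)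
  -- Corollary 1 for all prefixes `≤ N`
  have ht3 : (2 : ℝ) ^ t ≤ Real.exp (c₃ * Real.sqrt L) := by
    refine ht.trans (Real.exp_le_exp.2 ?_); rw [hcdef]; nlinarith
  set Bnd : ℝ := C₃ * N * Real.exp (-(c₃ * Real.sqrt L)) with hBnd
  have hBnd0 : 0 ≤ Bnd := by positivity
  have hpre : ∀ m : ℕ, m ≤ N → ‖afExpSum (fun n ↦ (μ n : ℝ)) m ((a : ℝ) / 2 ^ t)‖ ≤ Bnd :=
    fun m hm ↦ hadd N hN t ht3 a m hm
  -- summation by parts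
  set f : ℕ → ℂ := fun i ↦ (𝐞 ((i : ℝ) * β) : ℂ) with hfdef
  set g : ℕ → ℂ := fun i ↦ ((μ i : ℝ) : ℂ) * (𝐞 ((i : ℝ) * ((a : ℝ) / 2 ^ t)) : ℂ) with hgdef
  have hg0 : g 0 = 0 := by simp [hgdef]
  have hG : ∀ m : ℕ, ∑ i ∈ Finset.range (m + 1), g i =
      afExpSum (fun n ↦ (μ n : ℝ)) m ((a : ℝ) / 2 ^ t) := by
    intro m
    rw [sum_range_succ_eq_sum_Icc hg0]
    rfl
  have hS : afExpSum (fun n ↦ (μ n : ℝ)) X θ = ∑ i ∈ Finset.range (X + 1), f i • g i := by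
    have hfg0 : (fun i ↦ f i • g i) 0 = 0 := by simp [hgdef]
    rw [sum_range_succ_eq_sum_Icc hfg0]
    unfold afExpSum
    refine Finset.sum_congr rfl fun n _ ↦ ?_
    simp only [hfdef, hgdef, smul_eq_mul]
    have : (n : ℝ) * θ = (n : ℝ) * β + (n : ℝ) * ((a : ℝ) / 2 ^ t) := by rw [hβdef]; ring
    rw [this, AddChar.map_add_eq_mul, Circle.coe_mul]
    ring
  rw [hS, Finset.sum_range_by_parts]
  -- the boundary term
  have hnf : ∀ i : ℕ, ‖f i‖ = 1 := fun i ↦ norm_fourierChar _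
  have hdiff : ∀ i : ℕ, ‖f (i + 1) - f i‖ ≤ 2 * Real.pi * |β| := by
    intro i
    have : f (i + 1) - f i = f i * ((𝐞 β : ℂ) - 1) := by
      simp only [hfdef]
      push_cast
      rw [add_mul, one_mul, AddChar.map_add_eq_mul, Circle.coe_mul]
      ring
    rw [this, norm_mul, hnf, one_mul]
    exact norm_fourierChar_sub_one_le β
  have hX1N : ∀ i ∈ Finset.range (X + 1 - 1), i + 1 ≤ N := by
    intro i hi
    rw [Finset.mem_range] at hi
    omega
  have h1 : ‖f (X + 1 - 1) • ∑ i ∈ Finset.range (X + 1), g i‖ ≤ Bnd := by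
    rw [smul_eq_mul, norm_mul, hnf, one_mul, hG]
    exact hpre X hXN
  have h2 : ‖∑ i ∈ Finset.range (X + 1 - 1), (f (i + 1) - f i) • ∑ j ∈ Finset.range (i + 1), g j‖ ≤
      X * (2 * Real.pi * |β| * Bnd) := by
    calc ‖∑ i ∈ Finset.range (X + 1 - 1), (f (i + 1) - f i) • ∑ j ∈ Finset.range (i + 1), g j‖
        ≤ ∑ i ∈ Finset.range (X + 1 - 1), ‖(f (i + 1) - f i) • ∑ j ∈ Finset.range (i + 1), g j‖ :=
          norm_sum_le _ _
      _ ≤ ∑ i ∈ Finset.range (X + 1 - 1), 2 * Real.pi * |β| * Bnd := by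
          refine Finset.sum_le_sum fun i hi ↦ ?_
          rw [smul_eq_mul, norm_mul, hG]
          exact mul_le_mul (hdiff i) (hpre i (by have := hX1N i hi; omega)) (norm_nonneg _)
            (by positivity)
      _ = X * (2 * Real.pi * |β| * Bnd) := by
          rw [Finset.sum_const, Finset.card_range, nsmul_eq_mul, Nat.add_sub_cancel]
  have hXR : (X : ℝ) ≤ N := by exact_mod_cast hXN
  have hβN : (X : ℝ) * |β| ≤ Q := by
    have h := mul_le_mul hXR hθ (abs_nonneg _) hN0.le
    calc (X : ℝ) * |β| ≤ N * (Real.exp (c * Real.sqrt (Real.log N)) / N) := h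
      _ = Q := by rw [hQdef, hL]; field_simp
  have hpi : Real.pi ≤ 7 / 2 := by have := Real.pi_lt_d2; linarith
  calc ‖f (X + 1 - 1) • ∑ i ∈ Finset.range (X + 1), g i -
        ∑ i ∈ Finset.range (X + 1 - 1), (f (i + 1) - f i) • ∑ j ∈ Finset.range (i + 1), g j‖
      ≤ ‖f (X + 1 - 1) • ∑ i ∈ Finset.range (X + 1), g i‖ +
        ‖∑ i ∈ Finset.range (X + 1 - 1), (f (i + 1) - f i) • ∑ j ∈ Finset.range (i + 1), g j‖ :=
        norm_sub_le _ _
    _ ≤ Bnd + X * (2 * Real.pi * |β| * Bnd) := add_le_add h1 h2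
    _ = Bnd * (1 + 2 * Real.pi * ((X : ℝ) * |β|)) := by ring
    _ ≤ Bnd * (1 + 2 * Real.pi * Q) := by
        refine mul_le_mul_of_nonneg_left ?_ hBnd0
        have := mul_le_mul_of_nonneg_left hβN (by positivity : (0 : ℝ) ≤ 2 * Real.pi)
        linarith
    _ ≤ Bnd * (8 * Q) := by
        refine mul_le_mul_of_nonneg_left ?_ hBnd0
        nlinarith
    _ = 8 * C₃ * N * Real.exp (-(c * Real.sqrt (Real.log N))) := by
        rw [hBnd, hQdef, hcdef, ← hL]
        have : Real.exp (-(c₃ * Real.sqrt L)) * Real.exp (c₃ / 2 * Real.sqrt L) =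
            Real.exp (-(c₃ / 2 * Real.sqrt L)) := by
          rw [← Real.exp_add]; congr 1; ring
        calc C₃ * N * Real.exp (-(c₃ * Real.sqrt L)) * (8 * Real.exp (c₃ / 2 * Real.sqrt L))
            = 8 * C₃ * N * (Real.exp (-(c₃ * Real.sqrt L)) * Real.exp (c₃ / 2 * Real.sqrt L)) := by
              ring
          _ = 8 * C₃ * N * Real.exp (-(c₃ / 2 * Real.sqrt L)) := by rw [this]

end Additive

end MoebiusDyadic

end Literature.NumberTheory.LFunctions
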